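import Mathlib.MeasureTheory.Measure.Lebesgue.EqHaar
import Mathlib.LinearAlgebra.Matrix.ToLin
import Mathlib.Topology.Instances.Matrix
import Summits.KontsevichZagierPeriods.KontsevichZagierPeriods.Theorems.SoloInformedTameEquidecompFamilies
import HarnessLib

/-!
# SoloInformed — a valid equi-affine tame dissection computes the volume of its source

Solo programme `solo-KontsevichZagierPeriods-informed`, session s138, file 3 of the kernel form of
COROLLARY SQ (tame Tarski circle squaring is impossible).  SOUNDNESS of the validity condition of
`SoloInformedTameEquidecompFamilies`: if the real parameter `p` is valid for the
`ℚ`-semialgebraic-fibred shape `σ` and the source `D₀`, then the rational polynomial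
`∏_j Pa_j` (the volume of the target box) evaluates at `p` to `(volume D₀).toReal`:

  `vol D₀ = Σ_i vol(piece_i) = Σ_i vol(image_i) = vol(∏_j [0, a_j(p)]) = ∏_j a_j(p)`,

the pieces being measurable (semialgebraic), pairwise disjoint with union `D₀`, the moving maps
`x ↦ M x + b` with `det M = ±1` preserving Lebesgue measure (`Measure.addHaar_image_linearMap`,
translation invariance), and the images — the preimages of the pieces under the polynomial inverse
maps — pairwise disjoint with union the box.  No finiteness of the volume is needed.

* `soloInformed_volume_image_equiAffine` — `vol((x ↦ M x + b) '' A) = vol A` when `det M² = 1`;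
* `soloInformed_image_equiAffine_eq_preimage` — `(x ↦ M x + b) '' A = (affine inverse) ⁻¹' A`;
* `SoloInformedTameShape.aeval_prod_side_eq_volume` — **soundness**.

References: Bochnak–Coste–Roy (1998) §2.2 (semialgebraic sets are Borel); Banach (1923) / Tarski
(1925) (finitely additive invariant measures and the circle-squaring problem).
-/

noncomputable section

namespace Summit.KontsevichZagierPeriods.KontsevichZagierPeriods.Theorems

open Set MvPolynomial MeasureTheory Literature.ModelTheory.ExponentialFields
  Literature.NumberTheory.Transcendental

/-- `x² = 1 ⇒ |x| = 1` in `ℝ`. [folklore] -/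
theorem soloInformed_abs_eq_one_of_sq_eq_one {x : ℝ} (hx : x ^ 2 = 1) : |x| = 1 := by
  have h2 : |x| ^ 2 = 1 := by rw [sq_abs]; exact hx
  nlinarith [abs_nonneg x, h2]

/-- **Equi-affine maps preserve Lebesgue (outer) measure**: `vol((x ↦ M x + b) '' A) = vol A` for
every set `A ⊆ ℝⁿ` when `det M² = 1`. [folklore] -/
theorem soloInformed_volume_image_equiAffine {n : ℕ} (M : Matrix (Fin n) (Fin n) ℝ)
    (hM : M.det ^ 2 = 1) (b : Fin n → ℝ) (A : Set (Fin n → ℝ)) :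
    volume ((fun x => M.mulVec x + b) '' A) = volume A := by
  have himg : (fun x => M.mulVec x + b) '' A = (fun y => y + b) '' (Matrix.toLin' M '' A) := by
    rw [Set.image_image]
    simp only [Matrix.toLin'_apply]
  rw [himg, Set.image_add_right, measure_preimage_add_right, Measure.addHaar_image_linearMap,
    LinearMap.det_toLin', soloInformed_abs_eq_one_of_sq_eq_one hM, ENNReal.ofReal_one, one_mul]

/-- The image of a set under `x ↦ M x + b` (`det M² = 1`) is its preimage under the polynomial
inverse `soloInformedAffInv M b`. [folklore] -/
theorem soloInformed_image_equiAffine_eq_preimage {n : ℕ} (M : Matrix (Fin n) (Fin n) ℝ)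
    (hM : M.det ^ 2 = 1) (b : Fin n → ℝ) (A : Set (Fin n → ℝ)) :
    (fun x => M.mulVec x + b) '' A = (soloInformedAffInv M b) ⁻¹' A := by
  ext y
  constructor
  · rintro ⟨x, hx, rfl⟩
    rw [mem_preimage, soloInformedAffInv_mulVec_add M hM]
    exact hx
  · intro hy
    exact ⟨soloInformedAffInv M b y, hy, soloInformed_mulVec_affInv_add M hM b y⟩

/-- The polynomial inverse map is continuous. [folklore] -/
theorem soloInformed_continuous_affInv {n : ℕ} (M : Matrix (Fin n) (Fin n) ℝ) (b : Fin n → ℝ) :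
    Continuous (soloInformedAffInv M b) := by
  have h1 : Continuous fun y : Fin n → ℝ => y - b := continuous_id.sub continuous_const
  have h2 : Continuous fun y : Fin n → ℝ => M.adjugate.mulVec (y - b) :=
    continuous_const.matrix_mulVec h1
  exact h2.const_smul M.det

namespace SoloInformedTameShape

variable {K : Type*} {n N : ℕ} (σ : SoloInformedTameShape K n N)

/-- The pieces of a shape with `ℚ`-semialgebraic families are Lebesgue measurable.
[cite: BochnakCosteRoy1998, §2.2] -/
theorem measurableSet_piece {i : Fin N} (hS : IsSemialgebraic ℚ (σ.S i)) (p : K → ℝ) :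
    MeasurableSet (σ.piece i p) := by
  have hm : Measurable fun x : Fin n → ℝ => (Sum.elim p x : K ⊕ Fin n → ℝ) := by
    refine measurable_pi_lambda _ fun t => ?_
    cases t with
    | inl l => simpa only [Sum.elim_inl] using measurable_const
    | inr s => simpa only [Sum.elim_inr] using measurable_pi_apply s
  exact hm (IsSemialgebraic.measurableSet_holds hS)

/-- The `i`-th moving map at the parameter `p`. [folklore] -/
def move (i : Fin N) (p : K → ℝ) (x : Fin n → ℝ) : Fin n → ℝ := (σ.mat i p).mulVec x + σ.shift i p

/-- Under `det² = 1`, the image of the `i`-th piece under the `i`-th moving map is the preimage of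
the piece under `σ.inv i p`. [folklore] -/
theorem image_move_piece {i : Fin N} {p : K → ℝ} (hdet : (σ.mat i p).det ^ 2 = 1) :
    σ.move i p '' σ.piece i p = σ.inv i p ⁻¹' σ.piece i p :=
  soloInformed_image_equiAffine_eq_preimage _ hdet _ _

/-- **SOUNDNESS, measure form**: `volume D₀ = ENNReal.ofReal (∏_j a_j(p))`; in particular the
source of a valid dissection has finite volume. [folklore] -/
theorem volume_eq_of_valid {D₀ : Set (Fin n → ℝ)} {p : K → ℝ}
    (hS : ∀ i, IsSemialgebraic ℚ (σ.S i)) (hV : σ.Valid D₀ p) :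
    volume D₀ = ENNReal.ofReal (∏ j, σ.side p j) := by
  obtain ⟨hdet, hside, hz⟩ := σ.valid_iff.1 hV
  have hcover : D₀ = ⋃ i, σ.piece i p := by
    ext z
    rw [mem_iUnion]
    exact (hz z).1
  have hdisj : Pairwise (Function.onFun Disjoint fun i => σ.piece i p) := fun i j hij =>
    disjoint_left.2 fun z hzi hzj => (hz z).2.1 i j hij hzi hzj
  have hcover' : soloInformedTameBox (σ.side p) = ⋃ i, σ.inv i p ⁻¹' σ.piece i p := by
    ext y
    rw [mem_iUnion]
    exact (hz y).2.2.1
  have hdisj' : Pairwise (Function.onFun Disjoint fun i => σ.inv i p ⁻¹' σ.piece i p) := fun i j hij =>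
    disjoint_left.2 fun y hyi hyj => (hz y).2.2.2 i j hij hyi hyj
  have hmeas : ∀ i, MeasurableSet (σ.piece i p) := fun i => σ.measurableSet_piece (hS i) p
  have hmeas' : ∀ i, MeasurableSet (σ.inv i p ⁻¹' σ.piece i p) := fun i =>
    (soloInformed_continuous_affInv (σ.mat i p) (σ.shift i p)).measurable (hmeas i)
  have hvol : ∀ i, volume (σ.inv i p ⁻¹' σ.piece i p) = volume (σ.piece i p) := fun i => by
    rw [← σ.image_move_piece (hdet i)]
    exact soloInformed_volume_image_equiAffine _ (hdet i) _ _
  have h1 : volume D₀ = ∑ i, volume (σ.piece i p) := by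
    rw [hcover, measure_iUnion hdisj hmeas, tsum_fintype]
  have h2 : volume (soloInformedTameBox (σ.side p)) = ∑ i, volume (σ.piece i p) := by
    rw [hcover', measure_iUnion hdisj' hmeas', tsum_fintype]
    exact Finset.sum_congr rfl fun i _ => hvol i
  have hbox : volume (soloInformedTameBox (σ.side p)) = ENNReal.ofReal (∏ j, σ.side p j) := by
    rw [soloInformedTameBox, volume_pi_pi]
    simp only [Real.volume_Icc, sub_zero]
    rw [ENNReal.ofReal_prod_of_nonneg fun j _ => hside j]
  rw [h1, ← h2, hbox]

/-- **SOUNDNESS.** If `p` is valid for the shape `σ` (with `ℚ`-semialgebraic families) and the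
source `D₀`, then `∏_j a_j(p) = vol(D₀)`: the rational polynomial `∏_j Pa_j` evaluates at `p` to
`(volume D₀).toReal`. [folklore] -/
theorem aeval_prod_side_eq_volume {D₀ : Set (Fin n → ℝ)} {p : K → ℝ}
    (hS : ∀ i, IsSemialgebraic ℚ (σ.S i)) (hV : σ.Valid D₀ p) :
    aeval p (∏ j, σ.Pa j) = (volume D₀).toReal := by
  have hside : ∀ j, 0 ≤ σ.side p j := (σ.valid_iff.1 hV).2.1
  have hprod : aeval p (∏ j, σ.Pa j) = ∏ j, σ.side p j := by
    rw [map_prod]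
    rfl
  rw [hprod, σ.volume_eq_of_valid hS hV, ENNReal.toReal_ofReal (Finset.prod_nonneg fun j _ => hside j)]

end SoloInformedTameShape

end Summit.KontsevichZagierPeriods.KontsevichZagierPeriods.Theorems
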